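import Summits.PneNP.PneNP.Theorems.SzkEntropyPeaWorstToAvgDualModeCompileDefs
import Literature.Computability.Complexity.DegreeThreeEncodingEntropy
import Mathlib.Data.List.GetD

/-!
# Route SzkEntropy, crux `PeaWorstToAvg` (stmt-PneNP-10777), line `dual-mode-compile`, stub `stub_compile` — I:
# the symbolic Ishai–Kushilevitz matrix of an affine parity branching program

First file of the AIK compile `BPEA ≤ₚ PEA 3` (`stub_compile`).  For an affine parity branching program `P`
(`AffBP ℓ`, Ishai–Kushilevitz matrix `AffBP.mat`, value `AffBP.eval = det`) we set up

* the ℕ-presentation `natLab` / `natBP` of labels and programs (variable indices as naturals — the raw data the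
  polynomial-time program of file III reads off the code of a `BPEA` instance);
* the SYMBOLIC label `symLab a` (the affine label `c + Σ xᵢ` as a sparse polynomial) and the SYMBOLIC
  Ishai–Kushilevitz matrix `symHess P j l` (labels on and above the diagonal, the constant `1 = [[]]` on the
  subdiagonal, the zero polynomial `[]` below it) — the `Lsym` fed to the line's `blockOf`;
* the three side conditions of the one-block perfectness hypothesis `hblock` of `stub_compile` for `symHess`
  (`symHess_subdiag`, `symHess_below`, `symHess_vars`);
* `compileDet N Lsym v` — the determinant of the `N × N` evaluation of a symbolic matrix, the target of `hblock` — with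
  its dimension transport `compileDet_congr_dim`, its dependence on the prefix only (`compileDet_congr`), and the key identity
  `compileDet_symHess_natBP : compileDet P.length (symHess (natBP P)) (valOf x) = P.eval x`;
* support and degree of the line's `entryOf` / `blockOf` for a general symbolic matrix
  (`compile_mem_entryOf_vars/length`, `compile_varsIn_blockOf`, `compile_length_le_three_blockOf`);
* the OBJECTS of the compile (all definitions of the stub live in this file): the target `tgtBP P`, the block
  `blockBP n P` of ONE presented program (the constant polynomial `1` for the empty program — `det` of the empty
  matrix —, else the line's `blockOf n d (symHess P)`, `d = |P| - 1`, with `freshBP P = pos d d` fresh variables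
  from `n`), the compiled map `compileAux` of a LIST of programs (threading the fresh-variable counter as the tree's
  `RandPoly.encodeMap`; counters and supports `le_compileAux_fst`, `varsIn_blockBP`, `varsIn_compileAux`, prefix
  sums `prefixFresh`), the presented programs `natBPs F` of a multi-output program, and the compiled `PEA` instance
  `compileInst I = ⟨ℓ + s, (p̂, k + s)⟩` of a `BPEA` instance `I = ⟨ℓ, (F, k)⟩` (`p̂ = (compileAux ℓ (natBPs F)).2`
  re-indexed by `Fin (ℓ + s)` via `RandPoly.toFinMap`, `s = freshOfI I` fresh variables).

References: Y. Ishai, E. Kushilevitz, ICALP 2002, §3; B. Applebaum, Y. Ishai, E. Kushilevitz, SIAM J. Comput. 36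
(2006), §4.2; Z. Dvir, D. Gutfreund, G. Rothblum, S. Vadhan, ICS 2011, Thm. 4.5.
-/

namespace Summit.PneNP.PneNP.Cruxes.PeaWorstToAvg.DualModeCompile

open Literature.Computability.Complexity
open Literature.Computability.Complexity.RandPoly (evalP evalM mulP pos pairsLE symR1 symR2 AgreeBelow VarsIn
  valOf toFinMap evalP_append evalP_cons evalP_nil evalP_map_singleton rhoOf mem_mulP mem_symR1 mem_symR2 mem_pairsLE
  pos_lt_pos_self valOf_val varsIn_append)

set_option linter.dupNamespace false -- `Summit.PneNP.PneNP.…`: summit = sub-problem name (D-0017 single-conjunct layout)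

/-! ### ℕ-presentations of labels and programs -/

/-- The ℕ-presentation of an affine label (variable indices as naturals). [folklore] -/
def natLab {ℓ : ℕ} (a : AffLabel ℓ) : Bool × List ℕ := (a.1, a.2.map Fin.val)

/-- The ℕ-presentation of an affine parity branching program. [folklore] -/
def natBP {ℓ : ℕ} (P : AffBP ℓ) : List (List (Bool × List ℕ)) := P.map (List.map natLab)

/-- The default label `0` presents itself. [folklore] -/
@[simp] theorem natLab_default {ℓ : ℕ} : natLab ((false, []) : AffLabel ℓ) = (false, []) := rfl

/-- `natBP` preserves the number of nodes. [folklore] -/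
@[simp] theorem length_natBP {ℓ : ℕ} (P : AffBP ℓ) : (natBP P).length = P.length := List.length_map _

/-- Rows of `natBP P` are the presented rows of `P`. [folklore] -/
theorem getD_natBP {ℓ : ℕ} (P : AffBP ℓ) (j : ℕ) : (natBP P).getD j [] = (P.getD j []).map natLab := by
  show (P.map (List.map natLab)).getD j (List.map (natLab (ℓ := ℓ)) ([] : List (AffLabel ℓ))) = _
  exact List.getD_map _ _ _

/-- Labels of `natBP P` are the presented labels of `P`. [folklore] -/
theorem label_natBP {ℓ : ℕ} (P : AffBP ℓ) (j l : ℕ) :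
    ((natBP P).getD j []).getD (l - j) (false, []) = natLab (P.label j l) := by
  rw [getD_natBP, AffBP.label, ← natLab_default, List.getD_map]

/-- The variables of `natBP P` are below `ℓ`. [folklore] -/
theorem natBP_vars {ℓ : ℕ} (P : AffBP ℓ) : ∀ row ∈ natBP P, ∀ a ∈ row, ∀ x ∈ a.2, x < ℓ := by
  intro row hrow a ha x hx
  simp only [natBP, List.mem_map] at hrow
  obtain ⟨row', -, rfl⟩ := hrow
  obtain ⟨a', -, rfl⟩ := List.mem_map.1 ha
  simp only [natLab, List.mem_map] at hx
  obtain ⟨i, -, rfl⟩ := hx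
  exact i.isLt

/-! ### The symbolic label and the symbolic Ishai–Kushilevitz matrix -/

/-- The affine label `c + Σ_{i ∈ S} xᵢ` as a sparse polynomial: the empty monomial if `c = 1`, then the
singletons `[i]`. [cite: IshaiKushilevitz2002, §3] -/
def symLab (a : Bool × List ℕ) : List (List ℕ) := (if a.1 then [[]] else []) ++ a.2.map fun i => [i]

/-- **The symbolic Ishai–Kushilevitz matrix** of a presented program: the symbolic label of the edge `j → l + 1`
on and above the diagonal, the constant polynomial `1` on the subdiagonal, the zero polynomial below it.
[cite: IshaiKushilevitz2002, §3] -/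
def symHess (P : List (List (Bool × List ℕ))) (j l : ℕ) : List (List ℕ) :=
  if j ≤ l then symLab ((P.getD j []).getD (l - j) (false, [])) else if j = l + 1 then [[]] else []

/-- The default label is the zero polynomial. [folklore] -/
@[simp] theorem symLab_default : symLab (false, []) = [] := rfl

/-- Monomials of a symbolic label: at most one variable, from the label. [folklore] -/
theorem mem_symLab {a : Bool × List ℕ} {μ : List ℕ} (h : μ ∈ symLab a) : μ.length ≤ 1 ∧ ∀ x ∈ μ, x ∈ a.2 := by
  unfold symLab at h
  simp only [List.mem_append, List.mem_ite_nil_right, List.mem_singleton, List.mem_map] at h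
  rcases h with ⟨-, rfl⟩ | ⟨i, hi, rfl⟩
  · simp
  · simpa using hi

/-- Value of a symbolic label: the value of the affine label. [cite: IshaiKushilevitz2002, §3] -/
theorem evalP_symLab (v : ℕ → ZMod 2) (a : Bool × List ℕ) :
    evalP v (symLab a) = (if a.1 then 1 else 0) + (a.2.map v).sum := by
  rw [symLab, evalP_append, evalP_map_singleton]
  congr 1
  split_ifs <;> simp

/-- First side condition of `hblock`: the subdiagonal of `symHess` is the constant `1`. [folklore] -/
theorem symHess_subdiag (P : List (List (Bool × List ℕ))) : ∀ j l : ℕ, j = l + 1 → symHess P j l = [[]] := by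
  intro j l h
  simp [symHess, h]

/-- Second side condition of `hblock`: `symHess` vanishes below the subdiagonal. [folklore] -/
theorem symHess_below (P : List (List (Bool × List ℕ))) : ∀ j l : ℕ, l + 1 < j → symHess P j l = [] := by
  intro j l h
  simp [symHess, show ¬ j ≤ l by omega, show j ≠ l + 1 by omega]

/-- Monomials of the symbolic matrix: at most one variable, a variable of a label of the program. [folklore] -/
theorem mem_symHess {P : List (List (Bool × List ℕ))} {j l : ℕ} {μ : List ℕ} (h : μ ∈ symHess P j l) :
    μ.length ≤ 1 ∧ ∀ x ∈ μ, ∃ row ∈ P, ∃ a ∈ row, x ∈ a.2 := by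
  unfold symHess at h
  split_ifs at h with h1 h2
  · obtain ⟨hlen, hx⟩ := mem_symLab h
    refine ⟨hlen, fun x hxμ => ?_⟩
    have hx' := hx x hxμ
    by_cases hj : j < P.length
    · rw [List.getD_eq_getElem _ _ hj] at hx'
      by_cases hl : l - j < (P[j]).length
      · rw [List.getD_eq_getElem _ _ hl] at hx'
        exact ⟨P[j], List.getElem_mem hj, P[j][l - j], List.getElem_mem hl, hx'⟩
      · rw [List.getD_eq_default _ _ (not_lt.1 hl)] at hx'
        exact absurd hx' List.not_mem_nil
    · rw [List.getD_eq_default _ _ (not_lt.1 hj), List.getD_nil] at hx'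
      exact absurd hx' List.not_mem_nil
  · simp only [List.mem_singleton] at h
    subst h
    simp
  · exact absurd h List.not_mem_nil

/-- Third side condition of `hblock` (in the strong form "all entries"): if the labels of `P` use variables below
`n`, so does every entry of `symHess P`. [folklore] -/
theorem symHess_vars {P : List (List (Bool × List ℕ))} {n : ℕ} (hP : ∀ row ∈ P, ∀ a ∈ row, ∀ x ∈ a.2, x < n) :
    ∀ j l : ℕ, ∀ μ ∈ symHess P j l, ∀ x ∈ μ, x < n := by
  intro j l μ hμ x hx
  obtain ⟨row, hrow, a, ha, hxa⟩ := (mem_symHess hμ).2 x hx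
  exact hP row hrow a ha x hxa

/-- The entries of `symHess P` have degree `≤ 1`. [folklore] -/
theorem length_le_one_symHess (P : List (List (Bool × List ℕ))) :
    ∀ j l : ℕ, ∀ μ ∈ symHess P j l, μ.length ≤ 1 :=
  fun _ _ _ hμ => (mem_symHess hμ).1

/-- **The symbolic matrix of a program evaluates, at the valuation of an input, to its Ishai–Kushilevitz matrix.**
[cite: IshaiKushilevitz2002, §3] -/
theorem evalP_symHess_natBP {ℓ : ℕ} (P : AffBP ℓ) (x : Fin ℓ → ZMod 2) (j l : ℕ) :
    evalP (valOf x) (symHess (natBP P) j l) =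
      if j ≤ l then (P.label j l).eval x else if j = l + 1 then 1 else 0 := by
  unfold symHess
  split_ifs with h1 h2
  · rw [label_natBP, evalP_symLab, AffLabel.eval, natLab]
    simp only [List.map_map]
    congr 2
    exact List.map_congr_left fun i _ => by simp
  · simp
  · simp

/-! ### The determinant target -/

/-- The determinant of the `N × N` evaluation of a symbolic matrix at a valuation — the target of the one-block
perfectness hypothesis `hblock` of `stub_compile` (there with `N = d + 1`). [cite: IshaiKushilevitz2002, §3] -/
def compileDet (N : ℕ) (Lsym : ℕ → ℕ → List (List ℕ)) (v : ℕ → ZMod 2) : ZMod 2 :=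
  (Matrix.of fun j l : Fin N => evalP v (Lsym j.val l.val)).det

/-- Transport of the determinant target along an equality of dimensions. [folklore] -/
theorem compileDet_congr_dim {N M : ℕ} (h : N = M) (Lsym : ℕ → ℕ → List (List ℕ)) (v : ℕ → ZMod 2) :
    compileDet N Lsym v = compileDet M Lsym v := by
  subst h
  rfl

/-- The determinant target depends only on the variables of the symbolic matrix. [folklore] -/
theorem compileDet_congr {N n : ℕ} {Lsym : ℕ → ℕ → List (List ℕ)} (hL : ∀ j l : ℕ, ∀ μ ∈ Lsym j l, ∀ x ∈ μ, x < n)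
    {v w : ℕ → ZMod 2} (hvw : AgreeBelow n v w) : compileDet N Lsym v = compileDet N Lsym w := by
  unfold compileDet
  congr 1
  ext j l
  simp only [Matrix.of_apply]
  exact RandPoly.evalP_congr_below (hL j.val l.val) hvw

/-- **The determinant target of the symbolic matrix of a program is the value of the program.**
[cite: IshaiKushilevitz2002, §3] -/
theorem compileDet_symHess_natBP {ℓ : ℕ} (P : AffBP ℓ) (x : Fin ℓ → ZMod 2) :
    compileDet P.length (symHess (natBP P)) (RandPoly.valOf x) = P.eval x := by
  unfold compileDet AffBP.eval AffBP.mat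
  congr 1
  ext j l
  simp only [Matrix.of_apply, evalP_symHess_natBP]

/-- The empty program has value `1`. [folklore] -/
theorem compile_eval_nil {ℓ : ℕ} (x : Fin ℓ → ZMod 2) : AffBP.eval ([] : AffBP ℓ) x = 1 :=
  Matrix.det_eq_one_of_card_eq_zero (by simp)

/-! ### Support and degree of the block of a general symbolic matrix -/

/-- **Variables of an entry of `R₁ · Lsym · R₂`**: every variable of `entryOf n₀ d Lsym i k` is a variable of
`Lsym` (satisfies whatever `S` they satisfy) or a fresh variable in `[n₀, n₀ + pos d d)`.
[cite: IshaiKushilevitz2002, §3] -/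
theorem compile_mem_entryOf_vars {S : ℕ → Prop} {n₀ d : ℕ} {Lsym : ℕ → ℕ → List (List ℕ)}
    (hvar : ∀ j l : ℕ, ∀ μ ∈ Lsym j l, ∀ x ∈ μ, S x) {i k : ℕ} {μ : List ℕ}
    (h : μ ∈ entryOf n₀ d Lsym i k) : ∀ x ∈ μ, S x ∨ (n₀ ≤ x ∧ x < n₀ + pos d d) := by
  simp only [entryOf, List.mem_flatMap, List.mem_range] at h
  obtain ⟨j, hj, l, -, hμ⟩ := h
  obtain ⟨μ₁₂, h₁₂, μ₃, h₃, rfl⟩ := mem_mulP hμ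
  obtain ⟨μ₁, h₁, μ₂, h₂, rfl⟩ := mem_mulP h₁₂
  intro x hx
  simp only [List.mem_append] at hx
  rcases hx with (hx | hx) | hx
  · obtain ⟨rfl, hij⟩ := (mem_symR1 h₁).2 x hx
    have := pos_lt_pos_self (d := d) (le_of_lt hij) (by omega) (Or.inl hij)
    exact Or.inr ⟨Nat.le_add_right _ _, by omega⟩
  · exact Or.inl (hvar j l μ₂ h₂ x hx)
  · obtain ⟨rfl, hld⟩ := (mem_symR2 h₃).2 x hx
    have := pos_lt_pos_self (d := d) (le_refl l) (le_of_lt hld) (Or.inr hld)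
    exact Or.inr ⟨Nat.le_add_right _ _, by omega⟩

/-- **Degree of an entry of `R₁ · Lsym · R₂`**: if the entries of `Lsym` have degree `≤ e`, every monomial of
`entryOf n₀ d Lsym i k` has length `≤ e + 2` (one variable of `R₁`, one of `R₂`). [cite: IshaiKushilevitz2002, §3] -/
theorem compile_mem_entryOf_length {n₀ d e : ℕ} {Lsym : ℕ → ℕ → List (List ℕ)}
    (hdeg : ∀ j l : ℕ, ∀ μ ∈ Lsym j l, μ.length ≤ e) {i k : ℕ} {μ : List ℕ}
    (h : μ ∈ entryOf n₀ d Lsym i k) : μ.length ≤ e + 2 := by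
  simp only [entryOf, List.mem_flatMap, List.mem_range] at h
  obtain ⟨j, -, l, -, hμ⟩ := h
  obtain ⟨μ₁₂, h₁₂, μ₃, h₃, rfl⟩ := mem_mulP hμ
  obtain ⟨μ₁, h₁, μ₂, h₂, rfl⟩ := mem_mulP h₁₂
  have hl₁ := (mem_symR1 h₁).1
  have hl₂ := hdeg j l μ₂ h₂
  have hl₃ := (mem_symR2 h₃).1
  simp only [List.length_append]
  omega

/-- **Support of the block**: variables of `Lsym` or fresh variables in `[n₀, n₀ + pos d d)`. [cite: IshaiKushilevitz2002, §3] -/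
theorem compile_varsIn_blockOf {S : ℕ → Prop} {n₀ d : ℕ} {Lsym : ℕ → ℕ → List (List ℕ)}
    (hvar : ∀ j l : ℕ, ∀ μ ∈ Lsym j l, ∀ x ∈ μ, S x) :
    VarsIn (fun x => S x ∨ (n₀ ≤ x ∧ x < n₀ + pos d d)) (blockOf n₀ d Lsym) := by
  intro q hq μ hμ
  simp only [blockOf, List.mem_map] at hq
  obtain ⟨⟨i, k⟩, -, rfl⟩ := hq
  have hμ' : μ ∈ entryOf n₀ d Lsym i k := hμ
  exact compile_mem_entryOf_vars hvar hμ'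

/-- **Degree of the block**: if the entries of `Lsym` have degree `≤ 1`, every monomial of `blockOf n₀ d Lsym` has
length `≤ 3`. [cite: IshaiKushilevitz2002, §3] -/
theorem compile_length_le_three_blockOf {n₀ d : ℕ} {Lsym : ℕ → ℕ → List (List ℕ)}
    (hdeg : ∀ j l : ℕ, ∀ μ ∈ Lsym j l, μ.length ≤ 1) {q : List (List ℕ)} (hq : q ∈ blockOf n₀ d Lsym)
    {μ : List ℕ} (hμ : μ ∈ q) : μ.length ≤ 3 := by
  simp only [blockOf, List.mem_map] at hq
  obtain ⟨⟨i, k⟩, -, rfl⟩ := hq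
  have hμ' : μ ∈ entryOf n₀ d Lsym i k := hμ
  exact compile_mem_entryOf_length hdeg hμ'


/-! ### Objects of the compile: the block of one program, the compiled map, the compiled instance -/

/-- The target of a presented program at a valuation: `1` for the empty program (the empty determinant), else the
determinant of its symbolic Ishai–Kushilevitz matrix (`compileDet`, in the dimension `|P| - 1 + 1` of `hblock`).
[cite: IshaiKushilevitz2002, §3] -/
def tgtBP (P : List (List (Bool × List ℕ))) (v : ℕ → ZMod 2) : ZMod 2 :=
  if P.isEmpty then 1 else compileDet (P.length - 1 + 1) (symHess P) v

/-- The number of fresh variables of the block of a presented program: none for the empty program, else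
`pos d d = d(d+1)/2 + d`, `d = |P| - 1`. [cite: IshaiKushilevitz2002, §3] -/
def freshBP (P : List (List (Bool × List ℕ))) : ℕ :=
  if P.isEmpty then 0 else pos (P.length - 1) (P.length - 1)

/-- **The degree-3 block of one presented program** with fresh variables from `n`: the constant polynomial `1`
for the empty program, else the entries on and above the diagonal of `R₁ · symHess P · R₂` (`blockOf`).
[cite: IshaiKushilevitz2002, §3] [cite: ApplebaumIshaiKushilevitz2006, §4.2] -/
def blockBP (n : ℕ) (P : List (List (Bool × List ℕ))) : List (List (List ℕ)) :=
  if P.isEmpty then [[[]]] else blockOf n (P.length - 1) (symHess P)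

/-- **The compiled map of a list of presented programs**, block by block with consecutive fresh variables from
`n`; returns the new counter and the output polynomials. [cite: ApplebaumIshaiKushilevitz2006, §4.2] -/
def compileAux : ℕ → List (List (List (Bool × List ℕ))) → ℕ × List (List (List ℕ))
  | n, [] => (n, [])
  | n, P :: Ps => ((compileAux (n + freshBP P) Ps).1, blockBP n P ++ (compileAux (n + freshBP P) Ps).2)

/-! ### Counters and supports -/

/-- The counter of `compileAux` does not decrease. [folklore] -/
theorem le_compileAux_fst (n : ℕ) (Ps : List (List (List (Bool × List ℕ)))) : n ≤ (compileAux n Ps).1 := by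
  induction Ps generalizing n with
  | nil => exact le_rfl
  | cons P Ps ih => exact le_trans (Nat.le_add_right _ _) (ih (n + freshBP P))

/-- **Support of the block of one program**: variables below the bound `ℓ` on the program's variables, or fresh
variables in `[n, n + freshBP P)`. [cite: IshaiKushilevitz2002, §3] -/
theorem varsIn_blockBP {ℓ n : ℕ} {P : List (List (Bool × List ℕ))} (hP : ∀ row ∈ P, ∀ a ∈ row, ∀ x ∈ a.2, x < ℓ) :
    VarsIn (fun x => x < ℓ ∨ (n ≤ x ∧ x < n + freshBP P)) (blockBP n P) := by
  unfold blockBP freshBP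
  cases P with
  | nil =>
    intro q hq μ hμ x hx
    simp only [List.isEmpty_nil, ↓reduceIte, List.mem_singleton] at hq
    subst hq
    simp only [List.mem_singleton] at hμ
    subst hμ
    exact absurd hx List.not_mem_nil
  | cons r rs =>
    simp only [List.isEmpty_cons, Bool.false_eq_true, ↓reduceIte]
    exact compile_varsIn_blockOf (symHess_vars hP)

/-- **Support of the compiled map**: variables below `ℓ` (the bound on the programs' variables) or fresh variables
in `[n, counter)`. [folklore] -/
theorem varsIn_compileAux {ℓ : ℕ} (n : ℕ) (hℓn : ℓ ≤ n) (Ps : List (List (List (Bool × List ℕ))))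
    (hPs : ∀ P ∈ Ps, ∀ row ∈ P, ∀ a ∈ row, ∀ x ∈ a.2, x < ℓ) :
    VarsIn (fun x => x < ℓ ∨ (n ≤ x ∧ x < (compileAux n Ps).1)) (compileAux n Ps).2 := by
  induction Ps generalizing n with
  | nil => exact RandPoly.varsIn_nil _
  | cons P Ps ih =>
    have hle := le_compileAux_fst (n + freshBP P) Ps
    show VarsIn _ (blockBP n P ++ (compileAux (n + freshBP P) Ps).2)
    have e1 : (compileAux n (P :: Ps)).1 = (compileAux (n + freshBP P) Ps).1 := rfl
    refine varsIn_append.2 ⟨(varsIn_blockBP (hPs P (by simp))).mono fun x hx => ?_,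
      (ih (n + freshBP P) (by omega) fun P' hP' => hPs P' (List.mem_cons_of_mem _ hP')).mono fun x hx => ?_⟩
    · rcases hx with hx | hx
      · exact Or.inl hx
      · exact Or.inr ⟨hx.1, by omega⟩
    · rcases hx with hx | hx
      · exact Or.inl hx
      · exact Or.inr ⟨by omega, hx.2⟩

/-- Fresh variables consumed by the programs before index `i`. [folklore] -/
def prefixFresh (Ps : List (List (List (Bool × List ℕ)))) (i : ℕ) : ℕ := ((Ps.take i).map freshBP).sum

/-- The presented programs of a multi-output program. [folklore] -/
def natBPs {ℓ : ℕ} (F : AffBPMap ℓ) : List (List (List (Bool × List ℕ))) := F.map natBP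

/-- The variables of the presented programs are below `ℓ`. [folklore] -/
theorem natBPs_vars {ℓ : ℕ} (F : AffBPMap ℓ) : ∀ P ∈ natBPs F, ∀ row ∈ P, ∀ a ∈ row, ∀ x ∈ a.2, x < ℓ := by
  intro P hP
  simp only [natBPs, List.mem_map] at hP
  obtain ⟨P', -, rfl⟩ := hP
  exact natBP_vars P'

/-- The number of fresh variables of the compiled map of a `BPEA` instance. [cite: ApplebaumIshaiKushilevitz2006, §4.2] -/
def freshOfI (I : BPEAInst) : ℕ := (compileAux I.1 (natBPs I.2.1)).1 - I.1

/-- The counter of the compiled map is `ℓ + freshOfI I`. [folklore] -/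
theorem compileAux_fst_eq (I : BPEAInst) : (compileAux I.1 (natBPs I.2.1)).1 = I.1 + freshOfI I := by
  have := le_compileAux_fst I.1 (natBPs I.2.1)
  unfold freshOfI
  omega

/-- The variables of the compiled map of `⟨ℓ, (F, k)⟩` are below `ℓ + fresh`. [folklore] -/
theorem varsIn_compileAux_natBPs (I : BPEAInst) :
    VarsIn (fun x => x < I.1 + freshOfI I) (compileAux I.1 (natBPs I.2.1)).2 := by
  refine (varsIn_compileAux I.1 le_rfl (natBPs I.2.1) (natBPs_vars I.2.1)).mono fun x hx => ?_
  rw [← compileAux_fst_eq]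
  have := le_compileAux_fst I.1 (natBPs I.2.1)
  rcases hx with hx | hx <;> omega

/-- **The compiled `PEA` instance** `⟨ℓ + s, (p̂, k + s)⟩` of a `BPEA` instance `⟨ℓ, (F, k)⟩`: `p̂` the compiled map of
the presented programs with `s` fresh variables, the threshold shifted by `s`.
[cite: ApplebaumIshaiKushilevitz2006, §4.2] [cite: DvirGutfreundRothblumVadhan2010, Thm. 4.5] -/
noncomputable def compileInst (I : BPEAInst) : PEAInst :=
  ⟨I.1 + freshOfI I, (toFinMap (I.1 + freshOfI I) (compileAux I.1 (natBPs I.2.1)).2 (varsIn_compileAux_natBPs I),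
    I.2.2 + freshOfI I)⟩

end Summit.PneNP.PneNP.Cruxes.PeaWorstToAvg.DualModeCompile

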